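import Summits.Ventures.PercRepro.S2CoreTwentySix

/-!
# PercRepro — THE CORANK-`≥ 26` CORE THEOREM AT LEVEL `5` AT RANK `24` (p7, gen 3; sub-claim S2)

S2CoreTwentySix's argument at `p = 24`: `#Y ≥ Σ_{s=20}^{23} C(n, s)` (`choose_sum_le_midCount_of_bound`, `B = 19`,
`B + 2 = 21 ≤ 24`), the sum key `2^{29}·2^{14}·C(n, 5) ≤ C(29, 24)·Σ_{s=20}^{23} C(n, s)` at `n₀ = 50` (room `1.98`,
decided; it FAILS at `n = 2p = 48`) propagated to every `n ≥ 50` (`key_sum_of_base`), and the regime-II arithmetic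
`coreSharp_arith_II_of`; the clause is used at `n ≥ p + 26 = 50`. **`c025_core_five_nineteen_at_twentyfour`**. Axioms: standard.
-/

open scoped Matroid

namespace PercRepro

namespace ThmN

open Set

variable {α : Type}

/-- `Σ_{s ∈ [20, 23]} g s`, expanded. -/
theorem sum_Icc_twenty_twentythree (g : ℕ → ℕ) :
    ∑ s ∈ Finset.Icc 20 23, g s = g 20 + g 21 + g 22 + g 23 := by
  rw [show (23 : ℕ) = 22 + 1 from rfl, Finset.sum_Icc_succ_top (by norm_num),
    show (22 : ℕ) = 21 + 1 from rfl, Finset.sum_Icc_succ_top (by norm_num),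
    show (21 : ℕ) = 20 + 1 from rfl, Finset.sum_Icc_succ_top (by norm_num), Finset.Icc_self,
    Finset.sum_singleton]

/-- The sum key at `p = 24`, `q = 5`, `B = 19`, `n₀ = 50`: one numeral, decided. -/
theorem key_sum_twentyfour_base :
    2 ^ (24 + 5) * 2 ^ (19 - 5) * (50).choose 5 ≤ (24 + 5).choose 24 * ∑ s ∈ Finset.Icc 20 23, (50).choose s := by
  rw [sum_Icc_twenty_twentythree]
  decide

/-- **The `e`-free core at level `5`, rank `24`, every corank `≥ 26`** (`f(5) ≤ 19`): `#Y ≥ Σ_{s=20}^{23} C(n, s)`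
and the sum key from `n₀ = 50`. -/
theorem c025_core_five_nineteen_at_twentyfour (M : Matroid α) [M.Finite] (hbig : 24 + 25 < M.E.ncard)
    (hfree : ∀ e ∈ M.E, ∃ A ⊆ M.E \ {e}, e ∉ M.closure A ∧ e ∉ M.closure ((M.E \ {e}) \ A)) : RLS M 24 5 := by
  classical
  set n := M.E.ncard with hn_def
  have hEcard : M.ground_finite.toFinset.card = n := by
    rw [hn_def, Set.ncard_eq_toFinset_card _ M.ground_finite]
  have hBq' : ∀ X ⊆ M.E, M.eRk X ≤ 5 → X.ncard ≤ 19 := fun X hX hr =>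
    ncard_le_nineteen_of_eRk_le_five_of_free M hfree hX hr
  have hU : Matroid.topCount M 24 5 ≤ n.choose 5 * 2 ^ (19 - 5) := by
    calc Matroid.topCount M 24 5 ≤ Matroid.levelCount M 5 := Matroid.topCount_le_levelCount_bot 24 5
      _ = {X : Set α | X ⊆ M.E ∧ M.eRk X = 5}.ncard := rfl
      _ ≤ n.choose 5 * 2 ^ (19 - 5) := by rw [← hEcard]; exact ncard_eRk_eq_le_choose_mul_of_bound M 5 19 hBq'
  have hΦ := phiK_le_two_pow_div 24 5
  have hU0 : (0 : ℚ) ≤ (Matroid.topCount M 24 5 : ℚ) := by positivity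
  have hUq' : (Matroid.topCount M 24 5 : ℚ) ≤ (n.choose 5 : ℚ) * ((2 ^ (19 - 5) : ℕ) : ℚ) := by
    exact_mod_cast hU
  have hY := choose_sum_le_midCount_of_bound M hfree hBq' (show 19 + 2 ≤ 24 by norm_num)
  rw [hEcard] at hY
  have key := key_sum_of_base 24 5 (2 ^ (19 - 5)) ((24 + 5).choose 24) 50 (Finset.Icc 20 23)
    (fun s hs => by rw [Finset.mem_Icc] at hs; omega) (by norm_num)
  have hkey := key key_sum_twentyfour_base n (by omega)
  have hYq : ((∑ s ∈ Finset.Icc (19 + 1) (24 - 1), n.choose s : ℕ) : ℚ) ≤ (Matroid.midCount M 24 5 : ℚ) := by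
    exact_mod_cast hY
  rw [RLS_iff]
  exact coreSharp_arith_II_of hΦ hU0 hUq' hkey hYq

end ThmN

end PercRepro
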